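import Mathlib.Algebra.MvPolynomial.PDeriv
import Mathlib.Algebra.MvPolynomial.NoZeroDivisors
import Mathlib.Algebra.MvPolynomial.Nilpotent
import Mathlib.FieldTheory.IsAlgClosed.Basic
import HarnessLib

/-!
# Medini–Shpilka 2021, Observation 2.7: `f + g + c` is irreducible for non-constant,
# variable-disjoint, multilinear `f`, `g`

Medini–Shpilka, *Hitting sets and reconstruction for dense orbits in VP_e and ΣΠΣ circuits*
(arXiv:2102.05632; held text `paper:arxiv-2102.05632` p0016:L4–6), **Observation 2.7**
((irreducibleMultilinear)): "If `f, g` are non-constant, variable-disjoint, multilinear polynomials,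
then for every `c ∈ 𝔽` the polynomial `f(x) + g(x) + c` is irreducible." It is the irreducibility
input of the printed proof of Lemma 5.12 (roanfMonInc, p0028:L14 and L18), brick S1 of the sizing memo
`HOME/np/t20g5-MS21-lemma512-sizing.md` for the `MS2021_thm_35` consortium.

Proof (the source prints none; ours, characteristic-free): if `h = f + g + c = A·B` with `A, B`
non-units, multilinearity of `h` puts every variable of `h` in exactly one of `A`, `B`
(`degreeOf (A·B) = degreeOf A + degreeOf B` over a domain). For `x ∈ vars f ∩ vars A`,
`∂h/∂x = ∂f/∂x = (∂A/∂x)·B`, and `∂f/∂x ≠ 0` (degree exactly one in `x`), so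
`vars B ⊆ vars (∂f/∂x) ⊆ vars f`; the same with a variable of `g` (which then also lies in `A`) gives
`vars B ⊆ vars g`, whence `vars B = ∅` and `B` is a nonzero constant — a unit. Theorem-only; no
definitions, no named facts; nothing here bears on `VP ≠ VNP`.

## References
* [MediniShpilka2021] D. Medini, A. Shpilka, CCC 2021 / arXiv:2102.05632, Obs. 2.7 (p0016:L4–6).
-/

noncomputable section

open MvPolynomial Finset

namespace Literature.Computability.AlgebraicComplexity

namespace MS2021

variable {K : Type*} [Field K] {σ : Type*}

/-- The variables of a partial derivative are among the variables of the polynomial. [folklore] -/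
private theorem vars_pderiv_subset [DecidableEq σ] (i : σ) (p : MvPolynomial σ K) :
    (pderiv i p).vars ⊆ p.vars := by
  intro j hj
  rw [mem_vars_iff_mem_support] at hj ⊢
  obtain ⟨d, hd, hjd⟩ := hj
  rw [mem_support_iff, coeff_pderiv] at hd
  refine ⟨d + Finsupp.single i 1, mem_support_iff.mpr (left_ne_zero_of_mul hd), ?_⟩
  rw [Finsupp.mem_support_iff] at hjd ⊢
  rw [Finsupp.add_apply]
  omega

/-- A multilinear polynomial has a nonzero derivative in each of its variables (any characteristic).
[folklore] -/
private theorem pderiv_ne_zero_of_mem_vars_of_degreeOf_le_one {p : MvPolynomial σ K} {i : σ}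
    (hi : i ∈ p.vars) (h1 : p.degreeOf i ≤ 1) : pderiv i p ≠ 0 := by
  classical
  rw [mem_vars_iff_mem_support] at hi
  obtain ⟨d, hd, hid⟩ := hi
  have hdi : d i = 1 :=
    le_antisymm ((monomial_le_degreeOf i hd).trans h1) (Nat.one_le_iff_ne_zero.mpr
      (Finsupp.mem_support_iff.mp hid))
  intro h0
  have hc := congrArg (coeff (d - Finsupp.single i 1)) h0
  rw [coeff_pderiv, coeff_zero] at hc
  have hds : d - Finsupp.single i 1 + Finsupp.single i 1 = d := by
    ext j
    rw [Finsupp.add_apply, Finsupp.tsub_apply, Finsupp.single_apply]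
    by_cases hj : i = j
    · subst hj; rw [if_pos rfl]; omega
    · rw [if_neg hj]; omega
  have hdi0 : (d - Finsupp.single i 1 : σ →₀ ℕ) i = 0 := by
    rw [Finsupp.tsub_apply, Finsupp.single_eq_same, hdi]
  rw [hds, hdi0, Nat.cast_zero, zero_add, mul_one] at hc
  exact (mem_support_iff.mp hd) hc

/-- A polynomial without variables is a constant; a nonzero one is a unit. [folklore] -/
private theorem isUnit_of_vars_eq_empty {B : MvPolynomial σ K} (hB : B ≠ 0) (hv : B.vars = ∅) :
    IsUnit B := by
  classical
  have htd : B.totalDegree = 0 := by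
    rw [totalDegree]
    refine Nat.eq_zero_of_le_zero (Finset.sup_le fun d hd => ?_)
    rw [Finsupp.sum, Finset.sum_eq_zero]
    intro i hi
    have : i ∈ B.vars := (mem_vars_iff_mem_support i).mpr ⟨d, hd, hi⟩
    rw [hv] at this
    exact absurd this (Finset.notMem_empty _)
  have hC := totalDegree_eq_zero_iff_eq_C.mp htd
  rw [isUnit_iff_eq_C_of_isReduced]
  refine ⟨B.coeff 0, isUnit_iff_ne_zero.mpr fun h0 => hB ?_, hC⟩
  rw [hC, h0, C_0]

/-- The core step: if `h = A·B` is multilinear, `x ∈ vars A`, and `∂h/∂x = ∂p/∂x ≠ 0` with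
`vars (∂p/∂x) ⊆ vars p`, then `vars B ⊆ vars p`. [folklore] -/
private theorem vars_subset_of_factor [DecidableEq σ] {h A B p : MvPolynomial σ K} (hAB : h = A * B)
    (hA : A ≠ 0) (hB : B ≠ 0) (hh1 : ∀ i, h.degreeOf i ≤ 1) {x : σ} (hxA : x ∈ A.vars)
    (hder : pderiv x h = pderiv x p) (hpx : pderiv x p ≠ 0) : B.vars ⊆ p.vars := by
  -- `x ∉ vars B`
  have hxB : x ∉ B.vars := by
    intro hxB
    have h1 := hh1 x
    rw [hAB, degreeOf_mul_eq hA hB] at h1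
    have hA1 := mem_vars_iff_degreeOf_ne_zero.mp hxA
    have hB1 := mem_vars_iff_degreeOf_ne_zero.mp hxB
    omega
  -- `∂p/∂x = (∂A/∂x) · B`
  have hprod : pderiv x p = pderiv x A * B := by
    rw [← hder, hAB, Derivation.leibniz, pderiv_eq_zero_of_notMem_vars hxB, smul_zero, zero_add,
      smul_eq_mul, mul_comm]
  have hA' : pderiv x A ≠ 0 := by
    intro h0; rw [h0, zero_mul] at hprod; exact hpx hprod
  intro j hj
  refine vars_pderiv_subset x p ?_
  rw [hprod, mem_vars_iff_degreeOf_ne_zero, degreeOf_mul_eq hA' hB]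
  have := mem_vars_iff_degreeOf_ne_zero.mp hj
  omega

/-- **Medini–Shpilka 2021, Observation 2.7** ((irreducibleMultilinear)): "If `f, g` are non-constant,
variable-disjoint, multilinear polynomials, then for every `c ∈ 𝔽` the polynomial `f(x) + g(x) + c`
is irreducible." (Multilinear: degree `≤ 1` in every variable; non-constant: a variable occurs.)
[cite: MediniShpilka2021, Obs. 2.7] -/
theorem irreducible_add_add_C_of_multilinear_of_disjoint_vars [DecidableEq σ]
    {f g : MvPolynomial σ K} (hf1 : ∀ i, f.degreeOf i ≤ 1) (hg1 : ∀ i, g.degreeOf i ≤ 1)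
    (hdisj : Disjoint f.vars g.vars) (hf0 : f.vars.Nonempty) (hg0 : g.vars.Nonempty) (c : K) :
    Irreducible (f + g + C c) := by
  set h : MvPolynomial σ K := f + g + C c with hh
  -- variables and multilinearity of `h`
  have hvars : h.vars = f.vars ∪ g.vars := by
    rw [hh, vars_add_of_disjoint, vars_add_of_disjoint hdisj, vars_C, Finset.union_empty]
    rw [vars_C]; exact Finset.disjoint_empty_right _
  have hh1 : ∀ i, h.degreeOf i ≤ 1 := by
    intro i
    refine (degreeOf_add_le i _ _).trans (max_le ((degreeOf_add_le i _ _).trans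
      (max_le (hf1 i) (hg1 i))) ?_)
    rw [degreeOf_C]; exact Nat.zero_le _
  have hne : h ≠ 0 := by
    intro h0
    obtain ⟨x, hx⟩ := hf0
    have : x ∈ h.vars := by rw [hvars]; exact Finset.mem_union_left _ hx
    rw [h0, vars_0] at this
    exact Finset.notMem_empty _ this
  -- derivatives in the variables of `f` and of `g`
  have hderf : ∀ x ∈ f.vars, pderiv x h = pderiv x f := by
    intro x hx
    have hxg : x ∉ g.vars := Finset.disjoint_left.mp hdisj hx
    rw [hh, map_add, map_add, pderiv_eq_zero_of_notMem_vars hxg, pderiv_C, add_zero, add_zero]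
  have hderg : ∀ y ∈ g.vars, pderiv y h = pderiv y g := by
    intro y hy
    have hyf : y ∉ f.vars := Finset.disjoint_right.mp hdisj hy
    rw [hh, map_add, map_add, pderiv_eq_zero_of_notMem_vars hyf, pderiv_C, zero_add, add_zero]
  -- the factorisation argument, for `x ∈ vars f ∩ vars A`
  have key : ∀ A B : MvPolynomial σ K, h = A * B → A ≠ 0 → B ≠ 0 →
      (∃ x ∈ f.vars, x ∈ A.vars) → IsUnit B := by
    intro A B hAB hA hB ⟨x, hxf, hxA⟩
    have hBf : B.vars ⊆ f.vars := vars_subset_of_factor hAB hA hB hh1 hxA (hderf x hxf)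
      (pderiv_ne_zero_of_mem_vars_of_degreeOf_le_one hxf (hf1 x))
    obtain ⟨y, hyg⟩ := hg0
    have hyh : y ∈ h.vars := by rw [hvars]; exact Finset.mem_union_right _ hyg
    have hyB : y ∉ B.vars := fun hyB => Finset.disjoint_left.mp hdisj (hBf hyB) hyg
    have hyA : y ∈ A.vars := by
      rw [hAB] at hyh
      rcases Finset.mem_union.mp (vars_mul A B hyh) with h' | h'
      · exact h'
      · exact absurd h' hyB
    have hBg : B.vars ⊆ g.vars := vars_subset_of_factor hAB hA hB hh1 hyA (hderg y hyg)
      (pderiv_ne_zero_of_mem_vars_of_degreeOf_le_one hyg (hg1 y))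
    refine isUnit_of_vars_eq_empty hB (Finset.eq_empty_of_forall_notMem fun j hj => ?_)
    exact Finset.disjoint_left.mp hdisj (hBf hj) (hBg hj)
  refine ⟨fun hu => ?_, fun A B hAB => ?_⟩
  · -- `h` is not a unit: it has variables
    obtain ⟨r, -, hr⟩ := isUnit_iff_eq_C_of_isReduced.mp hu
    obtain ⟨x, hx⟩ := hf0
    have : x ∈ h.vars := by rw [hvars]; exact Finset.mem_union_left _ hx
    rw [hr, vars_C] at this
    exact Finset.notMem_empty _ this
  · have hA : A ≠ 0 := by intro h0; rw [h0, zero_mul] at hAB; exact hne hAB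
    have hB : B ≠ 0 := by intro h0; rw [h0, mul_zero] at hAB; exact hne hAB
    obtain ⟨x, hxf⟩ := hf0
    have hxh : x ∈ h.vars := by rw [hvars]; exact Finset.mem_union_left _ hxf
    rw [hAB] at hxh
    rcases Finset.mem_union.mp (vars_mul A B hxh) with hxA | hxB
    · exact Or.inr (key A B hAB hA hB ⟨x, hxf, hxA⟩)
    · exact Or.inl (key B A (hAB.trans (mul_comm A B)) hB hA ⟨x, hxf, hxB⟩)

end MS2021

end Literature.Computability.AlgebraicComplexity

end
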